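import Mathlib
import HarnessLib
import Summits.NavierStokesRegularity.NavierStokesRegularity.Theorems.PoloidalWindowDoorLrcModEntireTwistingTHFlatRidgeQuarticForm

/-!
# Item `LrcModEntire` (stmt-NavierStokesRegularity-20428) — THE FLAT SUB-CELL: WHEN IS THE TRANSVERSAL QUARTIC FORM DEFINITE? (`B₃² < −μ₀P²`), the tilted null line at equality

ns-k2-port-2 g7, helper of item 20428 (LEAD lineage ns-poloidal-K2-p3; `--supports stmt-NavierStokesRegularity-20428 --as helper`).  Memo `Cruxes/LrcModEntire/T2B-g15.md` §17b/§17c.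
The LEAD g15 flat lever (`…TwistingTHFlatLeverPointwise` / `…FlatSeparation` / `…FlatChain`) runs along a flat hot arc whose transversal quartic forms `Q_s(n,z)` are
DEFINITE, `λ(n⁴ + z⁴) ≤ Q_s(n,z)`.  At a single flat hot point the form is known explicitly (`…FlatRidgeQuarticForm.quarticForm_expansion_of_flatHotPoint`): with `ν = JT` the
secant direction, `P = ∂_ν⁴θ(y)`, `B₃ = D⁴θ(y)[ν,e₂,ν,ν]`, `μ₀ ≤ 0` the slope,
`F(n,z) := D⁴θ(y)[(nν + ze₂)⁴] = P(n⁴ − 6μ₀n²z² + μ₀²z⁴) + B₃(4n³z − 4μ₀nz³)`, `σF ≤ 0`.  This file decides definiteness in terms of the TWO numbers `P, B₃`: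

* `quartic_sos_identity` — the square-root-free identity **`(−σP)(−μ₀)(−σF(n,z)) = (−μ₀P² − B₃²)(n² − μ₀z²)² + (2(−σP)(−μ₀)·nz − σB₃(n² − μ₀z²))²`**;
* `quartic_definite_of_sq_lt` — `B₃² < −μ₀P²` ⇒ `∃ λ > 0, λ(n⁴+z⁴) ≤ −σF(n,z)` for all `n z` (explicit `λ`);
* `quartic_nullLine_of_sq_eq` — `B₃² = −μ₀P²` ⇒ **`F(−B₃t, Pt) = 0` for all `t`**: the form vanishes on the transversal line spanned by `−B₃ν + Pe₂`, which is TILTED out of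
  the thread plane when `P ≠ 0` (refuter1 g23 K-368's tight case `F = −(n − sz)⁴`), and is the vertical `e₂` when `μ₀ = 0` (then `B₃ = 0`);
* ★ `quartic_definite_iff` — under the sign condition `σF ≤ 0` (all `n z`), `σ = ±1`, `μ₀ ≤ 0`: **DEFINITE ⟺ `B₃² < −μ₀P²`** (⇒ uses the landed bound `|B₃| ≤ √(−μ₀)(−σP)`,
  which makes `B₃² ≤ −μ₀P²` always, and the null line at equality); in particular `μ₀ = 0` is NEVER definite;
* ★ `quarticDefinite_iff_of_flatHotPoint` — the same at every flat hot point of a `stub_T2bFlat` profile, in the binder currency of `quarticForm_expansion_of_flatHotPoint`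
  (`∃ μ₀ ≤ 0, ∃ T …`: definiteness of `(n,z) ↦ −σD⁴θ(y)[(nν+ze₂)⁴]` ⟺ `B₃² < −μ₀P²`, and the null line `D⁴θ(y)[(t(−B₃ν + Pe₂))⁴] = 0` when `B₃² = −μ₀P²`).

So along a flat hot arc the lever's hypothesis holds exactly where `B₃² < −μ₀P²`; where it fails with `P ≠ 0` the 4-jet of `u = N − σθ` has a null direction LEAVING the thread plane.

WHAT THIS IS NOT: not a claim about Navier–Stokes regularity and not a proof of `stub_T2bFlat`; fourth-order point structure for the OPEN flat sub-cell (bears_on LADDER-NS N0,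
item 20428 / crux 19708; OPEN).
-/

set_option linter.style.longLine false
set_option linter.dupNamespace false

namespace Summit.NavierStokesRegularity.NavierStokesRegularity.Theorems.PoloidalWindowDoorLrcModEntireTwistingTHFlatRidgeQuarticDefinite

open Set Function Filter Topology Metric
open scoped RealInnerProductSpace InnerProductSpace ContDiff
open Literature.Analysis Literature.Analysis.FluidPDE Literature.Analysis.UnboundedOperators
open Summit.NavierStokesRegularity.NavierStokesRegularity.Theorems
open Summit.NavierStokesRegularity.NavierStokesRegularity.Theorems.LocalSineTubeDoorProfileAlignedWindowRigidityAncient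
open Summit.NavierStokesRegularity.NavierStokesRegularity.Theorems.PoloidalWindowDoorLrcModEntireTwistingTHFlatRidgeQuarticForm

/-! ### Class-free algebra of the normal-form quartic `F(n,z) = P(n⁴ − 6μ₀n²z² + μ₀²z⁴) + B₃(4n³z − 4μ₀nz³)` -/

section ClassFree

/-- The normal-form binary quartic of the flat cell (as a polynomial function of `(n,z)` with parameters `P, B₃, μ₀`). -/
theorem quartic_AW_form (P B₃ μ₀ n z : ℝ) :
    P * (n ^ 4 - 6 * μ₀ * (n ^ 2 * z ^ 2) + μ₀ ^ 2 * z ^ 4) + B₃ * (4 * (n ^ 3 * z) - 4 * μ₀ * (n * z ^ 3)) =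
      P * ((n ^ 2 - μ₀ * z ^ 2) ^ 2 + 4 * (-μ₀) * (n ^ 2 * z ^ 2)) + 4 * B₃ * (n * z) * (n ^ 2 - μ₀ * z ^ 2) := by
  ring

/-- **The square-root-free sum-of-squares identity**: with `p = −σP`, `c₀ = −μ₀`, `b = σB₃`, `A = n² + c₀z²`,
`p·c₀·(−σF) = (p²c₀ − b²)A² + (2pc₀·nz − bA)²` (`σ = ±1`). [folklore] -/
theorem quartic_sos_identity {σ : ℝ} (hσ : σ = 1 ∨ σ = -1) (P B₃ μ₀ n z : ℝ) :
    (-(σ * P)) * (-μ₀) * (-(σ * (P * (n ^ 4 - 6 * μ₀ * (n ^ 2 * z ^ 2) + μ₀ ^ 2 * z ^ 4) + B₃ * (4 * (n ^ 3 * z) - 4 * μ₀ * (n * z ^ 3))))) =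
      (-μ₀ * P ^ 2 - B₃ ^ 2) * (n ^ 2 - μ₀ * z ^ 2) ^ 2 +
        (2 * (-(σ * P)) * (-μ₀) * (n * z) - σ * B₃ * (n ^ 2 - μ₀ * z ^ 2)) ^ 2 := by
  rcases hσ with rfl | rfl
  · ring
  · ring

/-- **The null line at equality**: if `B₃² = −μ₀P²` then `F(−B₃t, Pt) = 0` for every `t` — the form vanishes on the transversal line spanned by `−B₃ν + Pe₂`
(indeed `F(−B₃t, Pt) = t⁴P(μ₀P² − 3B₃²)(B₃² + μ₀P²)`). [folklore] -/
theorem quartic_nullLine_of_sq_eq {P B₃ μ₀ : ℝ} (h : B₃ ^ 2 = -μ₀ * P ^ 2) (t : ℝ) :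
    P * ((-B₃ * t) ^ 4 - 6 * μ₀ * ((-B₃ * t) ^ 2 * (P * t) ^ 2) + μ₀ ^ 2 * (P * t) ^ 4) +
      B₃ * (4 * ((-B₃ * t) ^ 3 * (P * t)) - 4 * μ₀ * ((-B₃ * t) * (P * t) ^ 3)) = 0 := by
  have h' : B₃ ^ 2 + μ₀ * P ^ 2 = 0 := by linarith
  linear_combination (t ^ 4 * P * (μ₀ * P ^ 2 - 3 * B₃ ^ 2)) * h'

/-- **Definite when `B₃² < −μ₀P²`**, with an explicit constant: `λ = (−μ₀P² − B₃²)·min(1, μ₀²)/((−σP)(−μ₀))`.  (The hypothesis forces `μ₀ < 0` and `P ≠ 0`; the sign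
`σP ≤ 0` is read off the sign condition at `(n,z) = (1,0)`.) -/
theorem quartic_definite_of_sq_lt {σ P B₃ μ₀ : ℝ} (hσ : σ = 1 ∨ σ = -1)
    (hform : ∀ n z : ℝ, σ * (P * (n ^ 4 - 6 * μ₀ * (n ^ 2 * z ^ 2) + μ₀ ^ 2 * z ^ 4) + B₃ * (4 * (n ^ 3 * z) - 4 * μ₀ * (n * z ^ 3))) ≤ 0)
    (hlt : B₃ ^ 2 < -μ₀ * P ^ 2) :
    ∃ lam : ℝ, 0 < lam ∧ ∀ n z : ℝ,
      lam * (n ^ 4 + z ^ 4) ≤ -(σ * (P * (n ^ 4 - 6 * μ₀ * (n ^ 2 * z ^ 2) + μ₀ ^ 2 * z ^ 4) + B₃ * (4 * (n ^ 3 * z) - 4 * μ₀ * (n * z ^ 3)))) := by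
  -- `μ₀ < 0` and `P ≠ 0`, `p = −σP > 0`
  have hδ : 0 < -μ₀ * P ^ 2 - B₃ ^ 2 := by linarith
  have hμP : 0 < -μ₀ * P ^ 2 := lt_of_le_of_lt (sq_nonneg B₃) hlt
  have hP0 : P ≠ 0 := by rintro rfl; simp at hμP
  have hP2 : 0 < P ^ 2 := by positivity
  have hc0 : 0 < -μ₀ := by
    by_contra hc
    push Not at hc
    nlinarith [hP2, hc]
  have hμsq : 0 < μ₀ ^ 2 := by
    have hμ0 : μ₀ ≠ 0 := by intro h; rw [h] at hc0; simp at hc0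
    positivity
  have hσP : σ * P ≤ 0 := by simpa using hform 1 0
  have hσ2 : σ ^ 2 = 1 := by rcases hσ with rfl | rfl <;> norm_num
  have hp : 0 < -(σ * P) := by
    rcases lt_or_eq_of_le hσP with h | h
    · linarith
    · exfalso
      have : σ * P = 0 := h
      rcases mul_eq_zero.1 this with hs | hP
      · rcases hσ with rfl | rfl <;> norm_num at hs
      · exact hP0 hP
  have hpc : 0 < -(σ * P) * -μ₀ := mul_pos hp hc0
  refine ⟨(-μ₀ * P ^ 2 - B₃ ^ 2) * min 1 (μ₀ ^ 2) / (-(σ * P) * -μ₀), div_pos (mul_pos hδ (lt_min one_pos hμsq)) hpc, fun n z => ?_⟩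
  have hid := quartic_sos_identity hσ P B₃ μ₀ n z
  -- drop the square: `p c₀ (−σF) ≥ δ A²`
  have hA : (-μ₀ * P ^ 2 - B₃ ^ 2) * (n ^ 2 - μ₀ * z ^ 2) ^ 2 ≤
      (-(σ * P)) * (-μ₀) * (-(σ * (P * (n ^ 4 - 6 * μ₀ * (n ^ 2 * z ^ 2) + μ₀ ^ 2 * z ^ 4) + B₃ * (4 * (n ^ 3 * z) - 4 * μ₀ * (n * z ^ 3))))) := by
    rw [hid]
    nlinarith [sq_nonneg (2 * (-(σ * P)) * (-μ₀) * (n * z) - σ * B₃ * (n ^ 2 - μ₀ * z ^ 2))]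
  -- `A² ≥ min(1, μ₀²)(n⁴ + z⁴)`
  have hmin : min 1 (μ₀ ^ 2) * (n ^ 4 + z ^ 4) ≤ (n ^ 2 - μ₀ * z ^ 2) ^ 2 := by
    have hn4 : (0 : ℝ) ≤ n ^ 4 := by positivity
    have hz4 : (0 : ℝ) ≤ z ^ 4 := by positivity
    have h1 : min 1 (μ₀ ^ 2) * n ^ 4 ≤ n ^ 4 := by
      have := min_le_left (1 : ℝ) (μ₀ ^ 2)
      nlinarith [this, hn4]
    have h2 : min 1 (μ₀ ^ 2) * z ^ 4 ≤ μ₀ ^ 2 * z ^ 4 := by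
      have := min_le_right (1 : ℝ) (μ₀ ^ 2)
      nlinarith [this, hz4]
    have h3 : n ^ 4 + μ₀ ^ 2 * z ^ 4 ≤ (n ^ 2 - μ₀ * z ^ 2) ^ 2 := by
      have hx : 0 ≤ -μ₀ * (n ^ 2 * z ^ 2) := mul_nonneg hc0.le (by positivity)
      nlinarith [hx]
    nlinarith [h1, h2, h3]
  -- assemble
  rw [div_mul_eq_mul_div, div_le_iff₀ hpc]
  calc (-μ₀ * P ^ 2 - B₃ ^ 2) * min 1 (μ₀ ^ 2) * (n ^ 4 + z ^ 4)
      = (-μ₀ * P ^ 2 - B₃ ^ 2) * (min 1 (μ₀ ^ 2) * (n ^ 4 + z ^ 4)) := by ring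
    _ ≤ (-μ₀ * P ^ 2 - B₃ ^ 2) * (n ^ 2 - μ₀ * z ^ 2) ^ 2 := mul_le_mul_of_nonneg_left hmin hδ.le
    _ ≤ _ := hA
    _ = _ := by ring

/-- ★ **DEFINITE ⟺ `B₃² < −μ₀P²`.**  Under the sign condition `σF ≤ 0` (all `n z`), `σ = ±1`, `μ₀ ≤ 0`: the normal-form quartic dominates `λ(n⁴ + z⁴)` for some `λ > 0`
iff `B₃² < −μ₀P²`.  (⇐ `quartic_definite_of_sq_lt`; ⇒: the landed bound `|B₃| ≤ √(−μ₀)(−σP)` gives `B₃² ≤ −μ₀P²`, and at equality the null line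
`quartic_nullLine_of_sq_eq` — or, when `P = 0`, the point `(1,0)` — defeats every `λ > 0`.)  In particular `μ₀ = 0` is never definite. -/
theorem quartic_definite_iff {σ P B₃ μ₀ : ℝ} (hσ : σ = 1 ∨ σ = -1) (hμ : μ₀ ≤ 0)
    (hform : ∀ n z : ℝ, σ * (P * (n ^ 4 - 6 * μ₀ * (n ^ 2 * z ^ 2) + μ₀ ^ 2 * z ^ 4) + B₃ * (4 * (n ^ 3 * z) - 4 * μ₀ * (n * z ^ 3))) ≤ 0) :
    (∃ lam : ℝ, 0 < lam ∧ ∀ n z : ℝ,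
      lam * (n ^ 4 + z ^ 4) ≤ -(σ * (P * (n ^ 4 - 6 * μ₀ * (n ^ 2 * z ^ 2) + μ₀ ^ 2 * z ^ 4) + B₃ * (4 * (n ^ 3 * z) - 4 * μ₀ * (n * z ^ 3))))) ↔
      B₃ ^ 2 < -μ₀ * P ^ 2 := by
  refine ⟨fun ⟨lam, hlam, hdef⟩ => ?_, quartic_definite_of_sq_lt hσ hform⟩
  by_contra hge
  push Not at hge
  -- the landed bound squares to `B₃² ≤ −μ₀P²`, so equality holds
  have hle : B₃ ^ 2 ≤ -μ₀ * P ^ 2 := by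
    have hb := abs_oddQuartic_le_of_form hσ hμ hform
    have hσP : σ * P ≤ 0 := by simpa using hform 1 0
    have h0 : 0 ≤ Real.sqrt (-μ₀) * -(σ * P) := mul_nonneg (Real.sqrt_nonneg _) (by linarith)
    have hsq : |B₃| ^ 2 ≤ (Real.sqrt (-μ₀) * -(σ * P)) ^ 2 := pow_le_pow_left₀ (abs_nonneg _) hb 2
    have hσ2 : σ ^ 2 = 1 := by rcases hσ with rfl | rfl <;> norm_num
    rw [sq_abs, mul_pow, Real.sq_sqrt (by linarith)] at hsq
    nlinarith [hsq, hσ2]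
  have heq : B₃ ^ 2 = -μ₀ * P ^ 2 := le_antisymm hle hge
  rcases eq_or_ne P 0 with hP | hP
  · -- `P = 0`: test at `(1, 0)`
    have h := hdef 1 0
    subst hP
    norm_num at h
    linarith
  · -- `P ≠ 0`: test on the null line at `t = 1`
    have h := hdef (-B₃ * 1) (P * 1)
    rw [quartic_nullLine_of_sq_eq heq 1] at h
    have hP4 : 0 < (P * 1) ^ 4 := by positivity
    have hB4 : (0 : ℝ) ≤ (-B₃ * 1) ^ 4 := by positivity
    nlinarith [hB4, hP4]

end ClassFree

/-! ### At a flat hot point of a `stub_T2bFlat` profile -/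

variable {C : ℝ} {v : ℝ → EuclideanSpace ℝ (Fin 3) → EuclideanSpace ℝ (Fin 3)}

/-- ★ **DEFINITENESS OF THE TRANSVERSAL QUARTIC FORM AT A FLAT HOT POINT ⟺ `B₃² < −μ₀P²`, AND THE TILTED NULL LINE AT EQUALITY.**  Binders of the flat cell VERBATIM
(as `…QuarticForm.quarticForm_expansion_of_flatHotPoint`), a flat hot point `y ∈ P₀`; with its data `μ₀ ≤ 0`, `T`, `ν = JT`, `P = ∂_ν⁴θ(y)`, `B₃ = D⁴θ(y)[ν,e₂,ν,ν]`
(`θ = v₂(−1,·)`, `F(n,z) = D⁴θ(y)[(nν+ze₂)⁴]`): (i) `(∃ λ > 0, ∀ n z, λ(n⁴+z⁴) ≤ −σF(n,z)) ⟺ B₃² < −μ₀P²`; (ii) if `B₃² = −μ₀P²` then `F(n,z) = 0` whenever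
`(n,z) = (−B₃t, Pt)` — the null line spanned by `−B₃ν + Pe₂`. -/
theorem quarticDefinite_iff_of_flatHotPoint (hdec : HasTypeITimeDecay C v) (hcont : ContinuousOn (uncurry v) (Iio (0 : ℝ) ×ˢ univ))
    (hmild : ∀ s t : ℝ, s < t → t < 0 → ∀ x, v t x = heatExtension (v s) (t - s) x - oseenDuhamel 1 s v v t x)
    (hdiv : ∀ t < 0, VectorCalculus.IsDivFree (v t))
    (hpol : ∀ s < 0, ∀ y, ⟪curl (v s) y, EuclideanSpace.single 2 1⟫_ℝ = 0)
    (hTH : ∀ t < 0, ∀ x x' : EuclideanSpace ℝ (Fin 3), x 2 = x' 2 → ∀ b c : Fin 3, b ≠ 2 → c ≠ 2 →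
      fderiv ℝ (v t) x (EuclideanSpace.single 2 1) b * fderiv ℝ (v t) x' (EuclideanSpace.single c 1) 2 =
        fderiv ℝ (v t) x' (EuclideanSpace.single 2 1) c * fderiv ℝ (v t) x (EuclideanSpace.single b 1) 2)
    (hne : v (-1) 0 2 ≠ 0) (hhot : ∀ t < 0, ∀ x, Real.sqrt (-t) * |v t x 2| ≤ |v (-1) 0 2|)
    (hproper : ∀ y ∈ {y : EuclideanSpace ℝ (Fin 3) | y 2 = 0 ∧ v (-1) y 2 = v (-1) 0 2}, ∀ r : ℝ, 0 < r →
      ∃ y' : EuclideanSpace ℝ (Fin 3), y' 2 = 0 ∧ dist y' y < r ∧ v (-1) y' 2 ≠ v (-1) 0 2)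
    (hni : ∀ K O : Set (EuclideanSpace ℝ (Fin 3)), IsCompact K → K.Nonempty → K ⊆ {y : EuclideanSpace ℝ (Fin 3) | y 2 = 0 ∧ v (-1) y 2 = v (-1) 0 2} →
      IsOpen O → K ⊆ O → O ∩ {y : EuclideanSpace ℝ (Fin 3) | y 2 = 0 ∧ v (-1) y 2 = v (-1) 0 2} ⊆ K → False)
    {σ : ℝ} (hσ : σ = 1 ∨ σ = -1) (hσN : σ * v (-1) 0 2 = |v (-1) 0 2|)
    (hflatAll : ∀ y : EuclideanSpace ℝ (Fin 3), y 2 = 0 → v (-1) y 2 = v (-1) 0 2 →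
      fderiv ℝ (fderiv ℝ (fun x => σ * v (-1) x 2)) y (EuclideanSpace.single 0 1) (EuclideanSpace.single 0 1) +
        fderiv ℝ (fderiv ℝ (fun x => σ * v (-1) x 2)) y (EuclideanSpace.single 1 1) (EuclideanSpace.single 1 1) = 0)
    {y : EuclideanSpace ℝ (Fin 3)} (hy0 : y 2 = 0) (hy : v (-1) y 2 = v (-1) 0 2) :
    ∃ μ₀ : ℝ, μ₀ ≤ 0 ∧ ∃ T : EuclideanSpace ℝ (Fin 3), T 2 = 0 ∧ ‖T‖ = 1 ∧
      ((∃ lam : ℝ, 0 < lam ∧ ∀ n z : ℝ, lam * (n ^ 4 + z ^ 4) ≤ -(σ * fderiv ℝ (fderiv ℝ (fun x => fderiv ℝ (fderiv ℝ (fun x' => (v (-1) x' 2 : ℝ))) x (n • ((-T 1) • EuclideanSpace.single 0 (1 : ℝ) + T 0 • EuclideanSpace.single 1 (1 : ℝ)) + z • EuclideanSpace.single 2 (1 : ℝ)) (n • ((-T 1) • EuclideanSpace.single 0 (1 : ℝ) + T 0 • EuclideanSpace.single 1 (1 : ℝ)) + z • EuclideanSpace.single 2 (1 : ℝ)))) y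 (n • ((-T 1) • EuclideanSpace.single 0 (1 : ℝ) + T 0 • EuclideanSpace.single 1 (1 : ℝ)) + z • EuclideanSpace.single 2 (1 : ℝ)) (n • ((-T 1) • EuclideanSpace.single 0 (1 : ℝ) + T 0 • EuclideanSpace.single 1 (1 : ℝ)) + z • EuclideanSpace.single 2 (1 : ℝ)))) ↔
        fderiv ℝ (fderiv ℝ (fun x => fderiv ℝ (fderiv ℝ (fun x' => (v (-1) x' 2 : ℝ))) x ((-T 1) • EuclideanSpace.single 0 (1 : ℝ) + T 0 • EuclideanSpace.single 1 (1 : ℝ)) ((-T 1) • EuclideanSpace.single 0 (1 : ℝ) + T 0 • EuclideanSpace.single 1 (1 : ℝ)))) y ((-T 1) • EuclideanSpace.single 0 (1 : ℝ) + T 0 • EuclideanSpace.single 1 (1 : ℝ)) (EuclideanSpace.single 2 1) ^ 2 < -μ₀ * fderiv ℝ (fderiv ℝ (fun x => fderiv ℝ (fderiv ℝ (fun x' => (v (-1) x' 2 : ℝ))) x ((-T 1) • EuclideanSpace.single 0 (1 : ℝ) + T 0 • EuclideanSpace.single 1 (1 : ℝ)) ((-T 1) • EuclideanSpace.single 0 (1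 : ℝ) + T 0 • EuclideanSpace.single 1 (1 : ℝ)))) y ((-T 1) • EuclideanSpace.single 0 (1 : ℝ) + T 0 • EuclideanSpace.single 1 (1 : ℝ)) ((-T 1) • EuclideanSpace.single 0 (1 : ℝ) + T 0 • EuclideanSpace.single 1 (1 : ℝ)) ^ 2) ∧
      (fderiv ℝ (fderiv ℝ (fun x => fderiv ℝ (fderiv ℝ (fun x' => (v (-1) x' 2 : ℝ))) x ((-T 1) • EuclideanSpace.single 0 (1 : ℝ) + T 0 • EuclideanSpace.single 1 (1 : ℝ)) ((-T 1) • EuclideanSpace.single 0 (1 : ℝ) + T 0 • EuclideanSpace.single 1 (1 : ℝ)))) y ((-T 1) • EuclideanSpace.single 0 (1 : ℝ) + T 0 • EuclideanSpace.single 1 (1 : ℝ)) (EuclideanSpace.single 2 1) ^ 2 = -μ₀ * fderiv ℝ (fderiv ℝ (fun x => fderiv ℝ (fderiv ℝ (fun x' => (v (-1) x' 2 : ℝ))) x ((-T 1) • EuclideanSpace.single 0 (1 : ℝ) + T 0 • EuclideanSpace.single 1 (1 : ℝ)) ((-T 1) • EuclideanSpace.single 0 (1 : ℝ) + T 0 •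 EuclideanSpace.single 1 (1 : ℝ)))) y ((-T 1) • EuclideanSpace.single 0 (1 : ℝ) + T 0 • EuclideanSpace.single 1 (1 : ℝ)) ((-T 1) • EuclideanSpace.single 0 (1 : ℝ) + T 0 • EuclideanSpace.single 1 (1 : ℝ)) ^ 2 →
        ∀ n z t : ℝ, n = -fderiv ℝ (fderiv ℝ (fun x => fderiv ℝ (fderiv ℝ (fun x' => (v (-1) x' 2 : ℝ))) x ((-T 1) • EuclideanSpace.single 0 (1 : ℝ) + T 0 • EuclideanSpace.single 1 (1 : ℝ)) ((-T 1) • EuclideanSpace.single 0 (1 : ℝ) + T 0 • EuclideanSpace.single 1 (1 : ℝ)))) y ((-T 1) • EuclideanSpace.single 0 (1 : ℝ) + T 0 • EuclideanSpace.single 1 (1 : ℝ)) (EuclideanSpace.single 2 1) * t → z = fderiv ℝ (fderiv ℝ (fun x => fderiv ℝ (fderiv ℝ (fun x' => (v (-1) x' 2 : ℝ))) x ((-T 1) • EuclideanSpace.single 0 (1 : ℝ) + T 0 • EuclideanSpace.single 1 (1 : ℝ)) ((-T 1) • EuclideanSpace.single 0 (1 : ℝ) + T 0 • EuclideanSpace.single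 1 (1 : ℝ)))) y ((-T 1) • EuclideanSpace.single 0 (1 : ℝ) + T 0 • EuclideanSpace.single 1 (1 : ℝ)) ((-T 1) • EuclideanSpace.single 0 (1 : ℝ) + T 0 • EuclideanSpace.single 1 (1 : ℝ)) * t →
          fderiv ℝ (fderiv ℝ (fun x => fderiv ℝ (fderiv ℝ (fun x' => (v (-1) x' 2 : ℝ))) x (n • ((-T 1) • EuclideanSpace.single 0 (1 : ℝ) + T 0 • EuclideanSpace.single 1 (1 : ℝ)) + z • EuclideanSpace.single 2 (1 : ℝ)) (n • ((-T 1) • EuclideanSpace.single 0 (1 : ℝ) + T 0 • EuclideanSpace.single 1 (1 : ℝ)) + z • EuclideanSpace.single 2 (1 : ℝ)))) y (n • ((-T 1) • EuclideanSpace.single 0 (1 : ℝ) + T 0 • EuclideanSpace.single 1 (1 : ℝ)) + z • EuclideanSpace.single 2 (1 : ℝ)) (n • ((-T 1) • EuclideanSpace.single 0 (1 : ℝ) + T 0 • EuclideanSpace.single 1 (1 : ℝ)) + z • EuclideanSpace.single 2 (1 : ℝ)) = 0) := by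
  obtain ⟨μ₀, hμ0, T, hT2, hT1, hform⟩ := quarticForm_expansion_of_flatHotPoint hdec hcont hmild hdiv hpol hTH hne hhot hproper hni hσN hflatAll hy0 hy
  refine ⟨μ₀, hμ0, T, hT2, hT1, ?_, ?_⟩
  · -- (i): transport `quartic_definite_iff` through the expansion
    have key := quartic_definite_iff hσ hμ0 (fun n z => (hform n z).2)
    refine Iff.trans ?_ key
    constructor
    · rintro ⟨lam, hlam, h⟩
      refine ⟨lam, hlam, fun n z => ?_⟩
      have h' := h n z
      rw [(hform n z).1] at h'
      exact h'
    · rintro ⟨lam, hlam, h⟩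
      refine ⟨lam, hlam, fun n z => ?_⟩
      rw [(hform n z).1]
      exact h n z
  · -- (ii): the null line
    intro heq n z t hn hz
    rw [(hform n z).1, hn, hz]
    exact quartic_nullLine_of_sq_eq heq t

end Summit.NavierStokesRegularity.NavierStokesRegularity.Theorems.PoloidalWindowDoorLrcModEntireTwistingTHFlatRidgeQuarticDefinite
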